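import Summits.ValiantsHypothesis.ValiantsHypothesis.Theorems.VPBoundarySquareNbBitSplit
import HarnessLib

/-!
# `VNPnb^ℂ` is closed under bit-splitting; `VNPnb^ℂ ⊆ VPnb^ℂ → VP = VNP ∧ B_nb` (route `VPBoundarySquare`)

FILE 1b of O-L3-14 «`B_nb` is the GRH-slot» (decomp-valiant lens 3, g38; aside `B_nb` = item 23487
= `VNPnbPFamSubsetVNP ℂ`). (L) `isVNPnbFamily_bitSplit`: for `f ∈ VNPnb^ℂ`, `f_n = Σ_e g_n(x,e)`
with `g` p-computable, the bit-splits `bitSplit L_n f_n` (`L_n := L(g_n)+1`, FILE 1a) form a `VNPnb`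
P-FAMILY — ONE Boolean sum, over the old cube and the `w_n L_n` frequency BITS selected by the
products `bitSel` (Bhargav–Dwivedi–Saxena 2024 §1.3), of the p-size WITNESS `splitSummand`
(`boolSum_splitSummand` = the Fourier formula of FILE 1a at `ω = exp(2πi/2^{L_n})`, constants free
in `VPnb^ℂ`; `complexity_splitSummand_le`). (T1 ⟹) `NbCollapse` (`VNPnb^ℂ ⊆ VPnb^ℂ`, verbatim the
conclusion of the named fact `Bur24_thm_4_10_2 ℂ`) implies `VP ℂ = VNP ℂ` (Bürgisser 2024 Rem. 4.9)
AND `B_nb`; and GRH's entire role in the lineage's conditional theorems is the slot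
`ERH → VP = VNP → NbCollapse` (`nbCollapse_of_ERH_of_collapse`, through which
`booleanNbDefinable_of_ERH_of_collapse` factors). The converse `VP = VNP ∧ B_nb → NbCollapse`
(bit-split, `B_nb`, power-substitute) and `B_nb → NF_ℂ` (Bürgisser 2024 Cor. 4.7's normal form over
`ℂ`) are staged next. Nothing here is constant-free (Bürgisser's `VNPnb⁰`-closure question, 2024
p0017, untouched); `B_nb` stays open; no tag moves. «`NbCollapse`» names the STATEMENT
`∀ v f, IsVNPnbFamily f → IsVPnbFamily f` (asserted for no field); it is written out in every
signature below (no `Prop` definition: a cited closed `Prop` would be a vendored fact).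

References: [BhargavDwivediSaxena2024, Lemma 4.1 (p. 13), §1.3 (p. 10), §6 (p. 16)];
[Burgisser2024Completeness, §4.2: Cor. 4.7, Thm. 4.8, Rem. 4.9, Thm. 4.10 (2) (p0016–p0017)].
-/

set_option linter.dupNamespace false

noncomputable section

open MvPolynomial Finset
open Literature.Computability.AlgebraicComplexity
open Literature.NumberTheory.LFunctions (ExtendedRiemannHypothesis)
open Summit.ValiantsHypothesis.ValiantsHypothesis.Theorems.VPBoundarySquareNbBitSplit

namespace Summit.ValiantsHypothesis.ValiantsHypothesis.Theorems.VPBoundarySquareNbGRHSlot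

section FieldLemmas

variable {F : Type*} [Field F]

/-- SELECTOR PRODUCT on bit-variables `v : Fin L → τ`: `Π_{j<L} (1 + X_{v j} · (c^{2^j} - 1))`; at a
Boolean point `e` it evaluates to `c^{binVal (e ∘ v)}` (the tree's `selPow c L` is the case
`v = Sum.inr`). [cite: BhargavDwivediSaxena2024, §1.3 (p. 10)] -/
def bitSel {τ : Type*} {L : ℕ} (c : F) (v : Fin L → τ) : MvPolynomial τ F :=
  ∏ j : Fin L, (1 + X (v j) * C (c ^ 2 ^ (j : ℕ) - 1))

/-- At a Boolean point the selector is `C (c ^ binVal)` (re-proof of the private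
`aeval_boolPoint_selPow` of `BDS24ExponentialInterpolation`). [folklore] -/
theorem aeval_bitSel_boolPoint {ρ : Type*} {L N : ℕ} (c : F) (v : Fin L → Fin N)
    (e : Fin N → Bool) :
    aeval (Sum.elim X fun j => if e j then (1 : MvPolynomial ρ F) else 0)
      (bitSel c fun j => (Sum.inr (v j) : ρ ⊕ Fin N)) = C (c ^ binVal fun j => e (v j)) := by
  unfold bitSel binVal
  rw [map_prod, ← prod_pow_eq_pow_sum, map_prod]
  refine prod_congr rfl fun j _ => ?_
  by_cases h : e (v j)
  · simp [h]
  · simp [h]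

/-- `L(bitSel c v) ≤ 3 L` (re-proof of the private `complexity_selPow_le`). [folklore] -/
theorem complexity_bitSel_le {τ : Type*} {L : ℕ} (c : F) (v : Fin L → τ) :
    complexity (bitSel c v) ≤ 3 * L := by
  unfold bitSel
  refine (complexity_finset_prod_le _ _).trans ?_
  have h : ∀ j ∈ (univ : Finset (Fin L)),
      complexity (1 + X (v j) * C (c ^ 2 ^ (j : ℕ) - 1) : MvPolynomial τ F) ≤ 2 := by
    intro j _
    calc complexity (1 + X (v j) * C (c ^ 2 ^ (j : ℕ) - 1) : MvPolynomial τ F)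
        ≤ complexity (1 : MvPolynomial τ F) +
            complexity (X (v j) * C (c ^ 2 ^ (j : ℕ) - 1) : MvPolynomial τ F) + 1 :=
          complexity_add_le_holds _ _
      _ ≤ 0 + (0 + 0 + 1) + 1 := by
          gcongr
          · rw [← C_1, complexity_C_holds]
          · exact (complexity_mul_le_holds _ _).trans
              (by rw [complexity_X_holds, complexity_C_holds])
      _ = 2 := by norm_num
  calc ∑ j : Fin L, complexity (1 + X (v j) * C (c ^ 2 ^ (j : ℕ) - 1) : MvPolynomial τ F)
          + (univ : Finset (Fin L)).card
      ≤ ∑ _j : Fin L, 2 + (univ : Finset (Fin L)).card := Nat.add_le_add_right (sum_le_sum h) _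
    _ = 3 * L := by
        simp only [sum_const, card_univ, Fintype.card_fin, smul_eq_mul]
        ring

/-- `L(1 + q · X y) ≤ L(q) + 2`. [folklore] -/
theorem complexity_one_add_mul_X_le {τ : Type*} (q : MvPolynomial τ F) (y : τ) :
    complexity (1 + q * X y) ≤ complexity q + 2 :=
  calc complexity (1 + q * X y)
      ≤ complexity (1 : MvPolynomial τ F) + complexity (q * X y) + 1 := complexity_add_le_holds _ _
    _ ≤ 0 + (complexity q + 0 + 1) + 1 := by
        gcongr
        · rw [← C_1, complexity_C_holds]
        · exact (complexity_mul_le_holds _ _).trans (by rw [complexity_X_holds])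
    _ = complexity q + 2 := by ring

/-- Boolean sums commute with constant factors (cf. `boolSum_C_mul` of the module
`VNPClosedUnderSum`, which is outside this file's import closure). [folklore] -/
theorem boolSum_C_mul' {τ : Type*} {m : ℕ} (c : F) (q : MvPolynomial (τ ⊕ Fin m) F) :
    boolSum (C c * q) = C c * boolSum q := by
  unfold boolSum
  rw [mul_sum]
  exact sum_congr rfl fun e _ => by rw [map_mul, aeval_C, algebraMap_eq]

/-- A factor free of Boolean variables leaves the Boolean sum. [folklore] -/
theorem boolSum_mul_rename_inl {τ : Type*} {m : ℕ} (q : MvPolynomial (τ ⊕ Fin m) F)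
    (r : MvPolynomial τ F) : boolSum (q * rename Sum.inl r) = boolSum q * r := by
  unfold boolSum
  rw [sum_mul]
  refine sum_congr rfl fun e _ => ?_
  rw [map_mul, aeval_rename]
  congr 1
  have : (Sum.elim X fun j => if e j then (1 : MvPolynomial τ F) else 0) ∘ Sum.inl = X := by
    ext1; rfl
  rw [this, aeval_X_left_apply]

/-- `deg g ≤ 2^{L(g)}` (fan-in-two degree bound). [folklore] -/
theorem totalDegree_le_two_pow_complexity {τ : Type*} (g : MvPolynomial τ F) :
    g.totalDegree ≤ 2 ^ complexity g := by
  obtain ⟨P, h2, hP, hs⟩ := ArithCircuit.exists_computes_size_eq_complexity g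
  have hPe : P.eval = g := hP
  calc g.totalDegree = P.eval.totalDegree := by rw [hPe]
    _ ≤ 2 ^ P.size := totalDegree_eval_le_two_pow_size h2
    _ = 2 ^ complexity g := by rw [hs]

variable {σ : Type*} [Fintype σ]

variable (σ) in
/-- Numbering of the `#σ · L` frequency bits. [folklore] -/
def bitEnc (L : ℕ) : σ × Fin L ≃ Fin (Fintype.card σ * L) :=
  ((Fintype.equivFin σ).prodCongr (Equiv.refl (Fin L))).trans finProdFinEquiv

/-- The `j`-th frequency bit of variable `i` (curried `bitEnc`, so that selector instances are
first-order). [folklore] -/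
def bitIdx (L : ℕ) (i : σ) (j : Fin L) : Fin (Fintype.card σ * L) :=
  bitEnc σ L (i, j)

variable (σ) in
/-- Boolean points of the numbered frequency bits ↔ bit vectors per variable. [folklore] -/
def bitsEquiv (L : ℕ) : (Fin (Fintype.card σ * L) → Bool) ≃ (σ → Fin L → Bool) where
  toFun e i j := e (bitEnc σ L (i, j))
  invFun b y := b ((bitEnc σ L).symm y).1 ((bitEnc σ L).symm y).2
  left_inv e := funext fun y => by simp
  right_inv b := funext fun i => funext fun j => by simp

/-- The cube identity re-indexed by the numbered frequency bits.
[cite: BhargavDwivediSaxena2024, Lemma 4.1 (p. 13)] -/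
theorem sum_bits_interpolate_eq_bitSplit {L : ℕ} {ω : F} (hω : IsPrimitiveRoot ω (2 ^ L))
    (p : MvPolynomial σ F) (hdeg : ∀ i, p.degreeOf i < 2 ^ L) :
    ∑ e : Fin (Fintype.card σ * L) → Bool,
        aeval (fun i => (C (ω ^ binVal fun j' => e (bitIdx L i j')) :
          MvPolynomial (σ × Fin L) F)) p *
        ∏ i, ∏ j : Fin L, (1 + C (((ω ^ 2 ^ (j : ℕ))⁻¹) ^ binVal fun j' => e (bitIdx L i j')) *
          X (i, j)) =
      C (((2 ^ L : ℕ) : F) ^ Fintype.card σ) * bitSplit L p := by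
  classical
  rw [← sum_boolCube_interpolate_eq_bitSplit hω p hdeg]
  exact Fintype.sum_equiv (bitsEquiv σ L) _ _ fun e => rfl

/-- The substitution of the witness: `x_i ↦ bitSel(ω) on the i-th frequency bits`, `e_a ↦ e_a`.
[cite: BhargavDwivediSaxena2024, Lemma 4.1 (p. 13)] -/
def splitSubst (L : ℕ) (ω : F) (u : ℕ) :
    σ ⊕ Fin u → MvPolynomial (((σ × Fin L) ⊕ Fin (Fintype.card σ * L)) ⊕ Fin u) F :=
  Sum.elim (fun i : σ => rename Sum.inl (bitSel ω fun j' : Fin L =>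
      (Sum.inr (bitIdx L i j') : (σ × Fin L) ⊕ Fin (Fintype.card σ * L))))
    fun a : Fin u => X (Sum.inr a)

/-- The selector-weighted product `Π_{i,j} (1 + bitSel(ω^{-2^j}) · y_ij)` of the witness.
[cite: BhargavDwivediSaxena2024, Lemma 4.1 (p. 13)] -/
def bitSelProd (L : ℕ) (ω : F) : MvPolynomial ((σ × Fin L) ⊕ Fin (Fintype.card σ * L)) F :=
  ∏ i : σ, ∏ j : Fin L, (1 + bitSel ((ω ^ 2 ^ (j : ℕ))⁻¹) (fun j' : Fin L =>
      (Sum.inr (bitIdx L i j') : (σ × Fin L) ⊕ Fin (Fintype.card σ * L))) *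
    X (Sum.inl (i, j)))

/-- **THE WITNESS** for `g ∈ F[x_σ, e_{Fin u}]`: the polynomial in the bit-split variables
`σ × Fin L` and the Boolean variables `Fin (#σ·L + u)` (frequency bits, then the old cube)
`(2^L)^{-#σ} · g(splitSubst) · bitSelProd`. [cite: BhargavDwivediSaxena2024, Lemma 4.1 (p. 13)] -/
def splitSummand (L : ℕ) (ω : F) {u : ℕ} (g : MvPolynomial (σ ⊕ Fin u) F) :
    MvPolynomial ((σ × Fin L) ⊕ Fin (Fintype.card σ * L + u)) F :=
  rename ((Equiv.sumAssoc (σ × Fin L) (Fin (Fintype.card σ * L)) (Fin u)).trans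
      (Equiv.sumCongr (Equiv.refl (σ × Fin L)) finSumFinEquiv))
    (C ((((2 ^ L : ℕ) : F) ^ Fintype.card σ)⁻¹) *
      (aeval (splitSubst L ω u) g * rename Sum.inl (bitSelProd L ω)))

/-- **The Boolean sum of the witness is the bit-split** of `f = Σ_e g(x,e)` when
`deg_{x_i} f < 2^L` and `ω` is a primitive `2^L`-th root of unity.
[cite: BhargavDwivediSaxena2024, Lemma 4.1 (p. 13)] -/
theorem boolSum_splitSummand (L : ℕ) {ω : F} (hω : IsPrimitiveRoot ω (2 ^ L)) {u : ℕ}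
    (g : MvPolynomial (σ ⊕ Fin u) F) (hdeg : ∀ i, (boolSum g).degreeOf i < 2 ^ L) :
    boolSum (splitSummand L ω g) = bitSplit L (boolSum g) := by
  haveI : NeZero (2 ^ L) := ⟨pow_ne_zero L two_ne_zero⟩
  have hD : (((2 ^ L : ℕ) : F) ^ Fintype.card σ) ≠ 0 := pow_ne_zero _ (hω.neZero').out
  have h1 : boolSum (aeval (splitSubst L ω u) g) = aeval (fun i : σ => bitSel ω fun j' : Fin L =>
      (Sum.inr (bitIdx L i j') : (σ × Fin L) ⊕ Fin (Fintype.card σ * L))) (boolSum g) :=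
    boolSum_aeval_extend _ g
  unfold splitSummand
  rw [← boolSum_boolSum, boolSum_C_mul', boolSum_mul_rename_inl, h1, boolSum_C_mul']
  generalize boolSum g = f at hdeg ⊢
  have hA : ∀ e : Fin (Fintype.card σ * L) → Bool,
      aeval (Sum.elim X fun j => if e j then (1 : MvPolynomial (σ × Fin L) F) else 0)
        (aeval (fun i : σ => bitSel ω fun j' : Fin L =>
          (Sum.inr (bitIdx L i j') : (σ × Fin L) ⊕ Fin (Fintype.card σ * L))) f) =
      aeval (fun i => (C (ω ^ binVal fun j' => e (bitIdx L i j')) :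
        MvPolynomial (σ × Fin L) F)) f := fun e => by
    have hθ : (fun i : σ => aeval (Sum.elim X fun j => if e j then (1 : MvPolynomial (σ × Fin L) F) else 0)
        (bitSel ω fun j' : Fin L => (Sum.inr (bitIdx L i j') : (σ × Fin L) ⊕ Fin (Fintype.card σ * L)))) =
        fun i => C (ω ^ binVal fun j' => e (bitIdx L i j')) := by
      funext i
      exact aeval_bitSel_boolPoint ω (bitIdx L i) e
    rw [comp_aeval_apply, hθ]
  have hP : ∀ e : Fin (Fintype.card σ * L) → Bool,
      aeval (Sum.elim X fun j => if e j then (1 : MvPolynomial (σ × Fin L) F) else 0)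
        (bitSelProd L ω) =
      ∏ i, ∏ j : Fin L, (1 + C (((ω ^ 2 ^ (j : ℕ))⁻¹) ^ binVal fun j' => e (bitIdx L i j')) *
        X (i, j)) := fun e => by
    unfold bitSelProd
    rw [map_prod]
    refine prod_congr rfl fun i _ => ?_
    rw [map_prod]
    refine prod_congr rfl fun j _ => ?_
    rw [map_add, map_one, map_mul, aeval_bitSel_boolPoint _ (bitIdx L i) e, aeval_X, Sum.elim_inl]
  unfold boolSum
  simp_rw [map_mul, hA, hP]
  rw [sum_bits_interpolate_eq_bitSplit hω f hdeg, ← mul_assoc, ← C_mul, inv_mul_cancel₀ hD,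
    C_1, one_mul]

/-- Size of the substitution. [folklore] -/
theorem complexity_splitSubst_sum_le (L : ℕ) (ω : F) (u : ℕ) :
    ∑ x, complexity (splitSubst (σ := σ) L ω u x) ≤ Fintype.card σ * (3 * L) := by
  rw [Fintype.sum_sum_type]
  have h0 : ∑ a : Fin u, complexity (splitSubst (σ := σ) L ω u (Sum.inr a)) = 0 :=
    sum_eq_zero fun a _ => complexity_X_holds _
  rw [h0, add_zero]
  calc ∑ i : σ, complexity (splitSubst L ω u (Sum.inl i))
      ≤ ∑ _i : σ, 3 * L := sum_le_sum fun i _ =>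
        (complexity_rename_le_holds' _ _).trans (complexity_bitSel_le _ _)
    _ = Fintype.card σ * (3 * L) := by rw [sum_const, card_univ, smul_eq_mul]

/-- Size of the selector-weighted product. [folklore] -/
theorem complexity_bitSelProd_le (L : ℕ) (ω : F) :
    complexity (bitSelProd (σ := σ) L ω) ≤ Fintype.card σ * (L * (3 * L + 2) + L) + Fintype.card σ := by
  have hrow : ∀ i : σ, complexity (∏ j : Fin L, (1 + bitSel ((ω ^ 2 ^ (j : ℕ))⁻¹)
      (fun j' : Fin L => (Sum.inr (bitIdx L i j') : (σ × Fin L) ⊕ Fin (Fintype.card σ * L))) *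
        X (Sum.inl (i, j)))) ≤ L * (3 * L + 2) + L := fun i => by
    refine (complexity_finset_prod_le _ _).trans ?_
    rw [card_univ, Fintype.card_fin]
    refine Nat.add_le_add_right ((sum_le_sum fun j _ => (complexity_one_add_mul_X_le _ _).trans
      (Nat.add_le_add_right (complexity_bitSel_le _ _) 2)).trans (le_of_eq ?_)) _
    rw [sum_const, card_univ, Fintype.card_fin, smul_eq_mul]
  unfold bitSelProd
  refine (complexity_finset_prod_le _ _).trans ?_
  rw [card_univ]
  refine Nat.add_le_add_right ((sum_le_sum fun i _ => hrow i).trans (le_of_eq ?_)) _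
  rw [sum_const, card_univ, smul_eq_mul]

/-- **Circuit size of the witness** — polynomial in `L(g)`, `#σ`, `L`.
[cite: BhargavDwivediSaxena2024, Lemma 4.1 (p. 13)] -/
theorem complexity_splitSummand_le (L : ℕ) (ω : F) {u : ℕ} (g : MvPolynomial (σ ⊕ Fin u) F) :
    complexity (splitSummand L ω g) ≤ complexity g + Fintype.card σ * (3 * L) +
      (Fintype.card σ * (L * (3 * L + 2) + L) + Fintype.card σ) + 2 := by
  unfold splitSummand
  refine (complexity_rename_le_holds' _ _).trans ?_
  calc complexity (C ((((2 ^ L : ℕ) : F) ^ Fintype.card σ)⁻¹) *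
        (aeval (splitSubst L ω u) g * rename Sum.inl (bitSelProd L ω)))
      ≤ complexity (C ((((2 ^ L : ℕ) : F) ^ Fintype.card σ)⁻¹) :
            MvPolynomial (((σ × Fin L) ⊕ Fin (Fintype.card σ * L)) ⊕ Fin u) F) +
          complexity (aeval (splitSubst L ω u) g * rename Sum.inl (bitSelProd L ω)) + 1 :=
        complexity_mul_le_holds _ _
    _ ≤ 0 + ((complexity g + Fintype.card σ * (3 * L)) +
          (Fintype.card σ * (L * (3 * L + 2) + L) + Fintype.card σ) + 1) + 1 := by
        gcongr
        · exact (complexity_C_holds _).le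
        · exact (complexity_mul_le_holds _ _).trans (add_le_add (add_le_add
            ((complexity_aeval_le _ _).trans
              (Nat.add_le_add_left (complexity_splitSubst_sum_le L ω u) _))
            ((complexity_rename_le_holds' _ _).trans (complexity_bitSelProd_le L ω))) le_rfl)
    _ = _ := by ring

end FieldLemmas

/-- **`VNPnb^ℂ` IS CLOSED UNDER BIT-SPLITTING.** For `f ∈ VNPnb` over `ℂ`, say `f_n = Σ_e g_n(x,e)`
with `g` p-computable, put `L_n := L(g_n) + 1` (so `deg_{x_i} f_n < 2^{L_n}`); then
`(bitSplit L_n f_n)_n ∈ VNPnb` — the Boolean sum, over the old cube AND the `w_n L_n` frequency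
bits, of the p-size witness `splitSummand` at `ω = exp(2πi/2^{L_n})` (Fourier inversion =
BDS 2024 Lemma 4.1; the constants `ω` are free in `VPnb^ℂ`) — and it is a p-family
(multilinear in `w_n L_n` variables). With FILE 1b: `VNPnb = VPnb ⟺ (VP = VNP ∧ B_nb)`.
[cite: BhargavDwivediSaxena2024, Lemma 4.1 (p. 13); Burgisser2024Completeness, Cor. 4.7,
Thm. 4.8, Rem. 4.9 (p0017)] -/
theorem isVNPnbFamily_bitSplit {w : ℕ → ℕ} {f : ∀ n, MvPolynomial (Fin (w n)) ℂ}
    (hf : IsVNPnbFamily f) :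
    ∃ L : ℕ → ℕ, IsPBounded L ∧ (∀ n i, (f n).degreeOf i < 2 ^ L n) ∧
      IsVNPnbFamily (fun n => bitSplit (L n) (f n)) ∧ IsPFamily (fun n => bitSplit (L n) (f n)) := by
  obtain ⟨u, g, hg, hfg⟩ := hf
  obtain ⟨hcard, hLg⟩ := (isVPnbFamily_iff_isPComputable g).1 hg
  have hw : IsPBounded w := hcard.mono fun n => by simp [Fintype.card_sum]
  have hu : IsPBounded u := hcard.mono fun n => by simp [Fintype.card_sum]
  let L : ℕ → ℕ := fun n => complexity (g n) + 1
  have hL : IsPBounded L := IsPBounded.add_holds hLg (IsPBounded.const 1)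
  have hdeg' : ∀ n i, (boolSum (g n)).degreeOf i < 2 ^ L n := fun n i =>
    (degreeOf_le_totalDegree _ _).trans_lt (((totalDegree_boolSum_le _).trans
      (totalDegree_le_two_pow_complexity _)).trans_lt
        (Nat.pow_lt_pow_right (by norm_num) (Nat.lt_succ_self _)))
  have hdeg : ∀ n i, (f n).degreeOf i < 2 ^ L n := fun n i => by rw [hfg n]; exact hdeg' n i
  let ω : ℕ → ℂ := fun t => Complex.exp (2 * Real.pi * Complex.I / ((2 ^ t : ℕ) : ℂ))
  have hω : ∀ t, IsPrimitiveRoot (ω t) (2 ^ t) := fun t =>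
    Complex.isPrimitiveRoot_exp (2 ^ t) (pow_ne_zero t two_ne_zero)
  refine ⟨L, hL, hdeg, ⟨fun n => Fintype.card (Fin (w n)) * L n + u n,
    fun n => splitSummand (L n) (ω (L n)) (g n), ?_, fun n => ?_⟩, ?_⟩
  · rw [isVPnbFamily_iff_isPComputable]
    refine ⟨(IsPBounded.add_holds (IsPBounded.mul_holds hw hL)
      (IsPBounded.add_holds (IsPBounded.mul_holds hw hL) hu)).mono fun n => ?_, ?_⟩
    · simp [Fintype.card_sum, Fintype.card_prod, Fintype.card_fin]
    · refine (IsPBounded.add_holds (IsPBounded.add_holds (IsPBounded.add_holds hLg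
        (IsPBounded.mul_holds hw (IsPBounded.mul_holds (IsPBounded.const 3) hL)))
        (IsPBounded.add_holds (IsPBounded.mul_holds hw (IsPBounded.add_holds
          (IsPBounded.mul_holds hL (IsPBounded.add_holds
            (IsPBounded.mul_holds (IsPBounded.const 3) hL) (IsPBounded.const 2))) hL)) hw))
        (IsPBounded.const 2)).mono fun n => ?_
      exact (complexity_splitSummand_le _ _ _).trans (by simp only [Fintype.card_fin]; exact le_rfl)
  · dsimp only
    rw [hfg n]
    exact (boolSum_splitSummand (L n) (hω (L n)) (g n) (hdeg' n)).symm
  · exact ⟨(IsPBounded.mul_holds hw hL).mono fun n => by simp [Fintype.card_prod, Fintype.card_fin],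
      (IsPBounded.mul_holds hw hL).mono fun n =>
        (totalDegree_bitSplit_le _ _).trans (by simp only [Fintype.card_fin]; exact le_rfl)⟩

/-! ### §3 «NbCollapse» = `VNPnb^ℂ ⊆ VPnb^ℂ` = `∀ v f, IsVNPnbFamily f → IsVPnbFamily f`

The statement (asserted for no field; verbatim the conclusion of the named fact `Bur24_thm_4_10_2 ℂ`,
Bürgisser 2024 Thm. 4.10 (2)) is written out on both sides of the proved arrows below:
hypothesis of `collapse_and_booleanNbDefinable_of_nbCollapse`, conclusion of
`nbCollapse_of_ERH_of_collapse`. -/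

/-- `NbCollapse → VP ℂ = VNP ℂ` (Bürgisser 2024, Rem. 4.9: a `VPnb` p-family is in `VP`).
[cite: Burgisser2024Completeness, Rem. 4.9 (p0017)] -/
theorem vp_eq_vnp_of_nbCollapse
    (h : ∀ (v : ℕ → ℕ) (f : ∀ n, MvPolynomial (Fin (v n)) ℂ), IsVNPnbFamily f → IsVPnbFamily f) :
    VP ℂ = VNP ℂ :=
  Set.ext fun G => show IsVPFamily G.poly ↔ IsVNPFamily G.poly from
    ⟨fun hG => IsVPFamily.isVNPFamily_holds' hG,
      fun hG => ⟨hG.1, ((isVPnbFamily_iff_isPComputable _).1 (h _ _ hG.isVNPnbFamily)).2⟩⟩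

/-- `NbCollapse → B_nb`: a p-family in `VNPnb` is then in `VPnb`, hence in `VP ⊆ VNP`.
[cite: Burgisser2024Completeness, Rem. 4.9 and Thm. 4.10 (2) (p0017)] -/
theorem booleanNbDefinable_of_nbCollapse
    (h : ∀ (v : ℕ → ℕ) (f : ∀ n, MvPolynomial (Fin (v n)) ℂ), IsVNPnbFamily f → IsVPnbFamily f) :
    VNPnbPFamSubsetVNP ℂ :=
  fun v f hpf hf => IsVPFamily.isVNPFamily_holds' ⟨hpf, ((isVPnbFamily_iff_isPComputable f).1 (h v f hf)).2⟩

/-- **T1 ⟹ (GRH-free half of the 4.10(2) skeleton)**: `VNPnb^ℂ ⊆ VPnb^ℂ → (VP ℂ = VNP ℂ ∧ B_nb)`.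
[cite: Burgisser2024Completeness, Rem. 4.9, Thm. 4.10 (2) (p0017)] -/
theorem collapse_and_booleanNbDefinable_of_nbCollapse
    (h : ∀ (v : ℕ → ℕ) (f : ∀ n, MvPolynomial (Fin (v n)) ℂ), IsVNPnbFamily f → IsVPnbFamily f) :
    VP ℂ = VNP ℂ ∧ VNPnbPFamSubsetVNP ℂ :=
  ⟨vp_eq_vnp_of_nbCollapse h, booleanNbDefinable_of_nbCollapse h⟩

/-- **THE GRH-SLOT**: GRH (with the named fact Thm. 4.10 (2)) enters exactly as
`VP = VNP → NbCollapse`; `booleanNbDefinable_of_ERH_of_collapse` (FILE `VPBoundarySquareNbTransfer`) is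
`booleanNbDefinable_of_nbCollapse ∘ nbCollapse_of_ERH_of_collapse`, so the lineage's
`{ERH, Bur24_thm_4_10_2}` debt is the single arrow `VP = VNP → B_nb`.
[cite: Burgisser2024Completeness, Thm. 4.10 (2) (p0017)] -/
theorem nbCollapse_of_ERH_of_collapse (hGRH : ExtendedRiemannHypothesis) (h410 : Bur24_thm_4_10_2 ℂ)
    (hEq : VP ℂ = VNP ℂ) :
    ∀ (v : ℕ → ℕ) (f : ∀ n, MvPolynomial (Fin (v n)) ℂ), IsVNPnbFamily f → IsVPnbFamily f :=
  fun v f hf => h410 hGRH hEq v f hf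

end Summit.ValiantsHypothesis.ValiantsHypothesis.Theorems.VPBoundarySquareNbGRHSlot

end
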